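import Summits.QuantumFields.BalabanUV.Beta.FP.TowerHLinkRows
import Summits.QuantumFields.BalabanUV.Beta.CompositeVertexKernelBounds

/-!
# `BalabanUV.Beta.FP.TowerLamStencilLocality` — road «FP», binder row D1, ROUTE T (β1): **THE ROAD's STOREY COEFFICIENT TABLES MAKE LOCAL Λ-STENCILS** — the letter
# `hLS : ∀ j, LocStencil (SLam N₁ (cf j) 𝒽) (Cs j) δ` of road `TorusLamJunctionShape.lamJunction_of_dper_eq` ((J-Λ) ⟸ one lattice identity) DISCHARGED for the road's data
# (`cf (n+1) := cfTop` — the transported straight-chart coefficients, an2 J-NOTE-1 (b); `cf k := δ` below the top, an2 W-3), ANY blocking letter `N₁`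

WHY (`HOME/b2b-balaban-beta-d1-p3/g41/SPEC-52.md` §D.2).  `lamJunction_of_dper_eq` (g38, p469378 ✓) and the g37∕g38 H-side files read the wrapper's Λ terms
`SLam N₁ (cf j) 𝒽 ā.2 ā.1` (`𝒽 μ y := symHessFFAt (toSite (ctrOff 4 Lc)) Lc μ y`) through ONE displayed locality letter `hLS` (with `hCs`, `hδ`); lit
`InterLevelTransport.locStencil_SLam` makes `SLam N c Q` local as soon as `|c μ y κ′ u| ≤ C·e^{−δ|N•y − u|₁}` and `Q` is a vertex family AT BLOCKING `N` — but the wrapper's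
`SLam` carries the literal's own letter `N` (`d1Tel_JcComp_ctr_namedC (hLc) (N) …`), not the brick blocking `Lc`.  THIS FILE: (§1) the VALUE of `SLam N c Q` does not depend
on `N` (lit `cwsum_apply`), so locality transfers between blocking letters; (§2) the δ-table is bounded by `1·e^{−δ|Lc•y − u|₁}` for EVERY `δ`; (§3) the top table `cfTop` decays
from `Lc•s` at half the rate of `KInv (Lc^{n+2})` (lit `abs_lamCoeffOf_le` at `decays_KInv`, F6a-bounds `abs_compLinKer_le` on an2 g60's FINITE window `compLinKer_eq_zero ∕
mem_winF_iff`, the window inequality `|Lc•s − Lc^{n+2}•w|₁ ≤ 4·Lc·wid`, `exp` bookkeeping and `Σ'_w e^{−(δ∕2)|Lc^{n+2}•w − u|₁} ≤ Zl 4 (δ∕2)` by injectivity); (§4) hence, with an2's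
`vertexFamily_symHessFFAt` at blocking `Lc`, ONE rate `δ > 0` and constants `Cs j ≥ 0` with `LocStencil (SLam N₁ (cf j) 𝒽) (Cs j) δ` for EVERY level `j` and EVERY `N₁` — the
instantiation's `obtain ⟨δ, hδ, Cs, hCs, hLS⟩`.

WHAT ([folklore] decay bookkeeping BY NAME; no `def`, no `def … : Prop`, nothing cited, 0 sorry; the table binder `cfF` with its DEFINING EQUATION `hcfF` as in `TowerHLinkRows`):
§1 `SLam_eq_of_neZero`, `locStencil_SLam_of_neZero`; §2 `abs_cfDelta_le`; §3 `l1_smul_sub_smul_le_of_mem_winF`, **`exists_abs_cfTop_le`**; §4 **`exists_locStencil_SLam_cf`**.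
WHAT THIS IS NOT: not `hΛN` (SPEC-52 §D.1), not (E4d)∕(E4e); no row of the END wrapper discharged; 0 estimates of Bałaban's (the decay constants are the tree's own, by name);
nothing of Bałaban's asserted, valued or discharged; 0∕4 row-D1 binders (hW, hR, D1Tel, D1Rep); ROOT M‴ p325680 ∕ P5c ∕ D6 untouched; NOT (C1), NOT (L2′), NOT (T-ID), NOT SDF,
NOT D1, NEVER «G-an2-4 closed», NOT BetaPertH, NOT continuum, NOT Clay.

HONEST DEPENDENCY (page 1, mandatory): continuum YM on T⁴ ⇐ BetaPertH ∧ nine spine estimates (0/9 proved); BetaPertH ⇐ (D1) ∧ (D4) ∧ CAP+tail;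
G-an2-4 gates asym, D1 and NE2/3/4.  HONEST FRAMING (cell contract, verbatim): «discharging `BetaPertH` makes Bałaban's UV stability UNCONDITIONAL —
a real constructive-QFT result; it is NOT the continuum limit and NOT the Clay problem.»  ABSOLUTE RULE (cell charter, verbatim): «No internally-minted
statement may enter as a cited fact. Every hypothesis is either kernel-proved in this package or a verbatim quotation of a PUBLISHED theorem with page
reference. The manuscript(s) under audit are NOT citable for their own disputed steps — they are the thing under adjudication; programme-internal
(2001/route/tribunal) claims are never citable.»  Road «FP» OWNER, b2b-balaban-beta-d1-p3 gen 41, 2026-08-27.  No existing file touched.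
-/

noncomputable section

open scoped BigOperators

namespace Summit.QuantumFields.BalabanUV.Beta.FP.TowerLamStencilLocality

open Finset
open Literature.MathematicalPhysics.QuantumFieldTheory
open Literature.MathematicalPhysics.QuantumFieldTheory.Balaban1983to89
open Literature.MathematicalPhysics.QuantumFieldTheory.Balaban1983to89.Beta
open B12Sec2to5 (l1 l1_nonneg)
open AffineAveraging (Site box toSite)
open AveragingHessianKernels (Bond ell)
open ExpKernelCalculus (MKer Decays BiLoc VertexFamily Zl Zl_nonneg l1_sub_triangle l1_sub_symm summable_exp_shift' tsum_exp_shift')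
open OneStepResolventKernel (Fib KInv LocStencil decays_KInv biLoc_mono)
open InterLevelTransport (SLam cwsum_apply locStencil_SLam)
open BalabanStepJets (lamCoeffOf abs_lamCoeffOf_le locStencil_mono)
open Summit.QuantumFields.BalabanUV.Beta.AxialDressingRooted (one_le_of_neZero)
open Summit.QuantumFields.BalabanUV.Beta.CompositeOneShotJetData (Roots)
open Summit.QuantumFields.BalabanUV.Beta.SymAveragingHessianCounts (symLinKerAt symHessFFAt abs_symLinKerAt_le vertexFamily_symHessFFAt)
open Summit.QuantumFields.BalabanUV.Beta.CompositeVertexKernelRec (compLinKer compLinKer_eq_zero wid winF mem_winF_iff abs_compLinKer_le)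
open Summit.QuantumFields.BalabanUV.Beta.CompositeVertexKernelLiftKernel (mem_piFinset_of_mem_winF)

variable {Lc : ℕ} [NeZero Lc] (R : Roots Lc) (n : ℕ)

/-! ## §1 The blocking letter of `SLam` is immaterial -/

section Blocking

omit [NeZero Lc] in
/-- [folklore] **the VALUE of `SLam N c Q` does not depend on `N`** (lit `cwsum_apply`: it is `−Σ_μ Σ'_y c μ y κ′ u·Q μ y x z a b`). -/
theorem SLam_eq_of_neZero (N₁ N₂ : ℕ) [NeZero N₁] [NeZero N₂] (c : Fin (3 + 1) → Site (3 + 1) → Fin (3 + 1) → Site (3 + 1) → ℝ)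
    (Q : Fin (3 + 1) → Site (3 + 1) → MKer (3 + 1) (Fib 3)) : SLam N₁ c Q = SLam N₂ c Q := by
  funext κ' u x z a b
  simp only [SLam, cwsum_apply]

omit [NeZero Lc] in
/-- [folklore] hence locality transfers between blocking letters. -/
theorem locStencil_SLam_of_neZero (N₁ N₂ : ℕ) [NeZero N₁] [NeZero N₂] {c : Fin (3 + 1) → Site (3 + 1) → Fin (3 + 1) → Site (3 + 1) → ℝ}
    {Q : Fin (3 + 1) → Site (3 + 1) → MKer (3 + 1) (Fib 3)} {C δ : ℝ} (h : LocStencil (SLam N₂ c Q) C δ) : LocStencil (SLam N₁ c Q) C δ := by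
  rw [SLam_eq_of_neZero N₁ N₂ c Q]
  exact h

end Blocking

/-! ## §2 The δ-table decays (trivially, at every rate) -/

section Delta

omit [NeZero Lc] in
/-- [folklore] `|[u = Lc•y ∧ κ′ = μ]| ≤ 1·e^{−δ|Lc•y − u|₁}` for every `δ` (the indicator is supported ON the centre). -/
theorem abs_cfDelta_le (δ : ℝ) (μ : Fin (3 + 1)) (y : Site (3 + 1)) (κ' : Fin (3 + 1)) (u : Site (3 + 1)) :
    |(if u = (Lc : ℤ) • y ∧ κ' = μ then (1 : ℝ) else 0)| ≤ 1 * Real.exp (-δ * l1 ((Lc : ℤ) • y - u)) := by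
  split_ifs with h
  · rw [h.1, sub_self, show l1 (0 : Site (3 + 1)) = 0 by simp [l1], mul_zero, Real.exp_zero, mul_one, abs_one]
  · rw [abs_zero, one_mul]; exact (Real.exp_pos _).le

end Delta

/-! ## §3 The top table decays from the slot's root at half the resolvent's rate -/

section Top

omit [NeZero Lc] in
/-- [folklore] **the window inequality**: if the level-one slot `s` lies in the depth-`(n+1)` window of the top slot `w` (an2 g60 `winF`), then
`|Lc•s − Lc^{n+2}•w|₁ ≤ 4·Lc·wid Lc (n+1)`. -/
theorem l1_smul_sub_smul_le_of_mem_winF {s w : Site (3 + 1)} (h : s ∈ winF (Lc ^ (n + 1)) (wid Lc (n + 1)) w) :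
    l1 ((Lc : ℤ) • s - ((Lc ^ (n + 1 + 1) : ℕ) : ℤ) • w) ≤ ((3 : ℝ) + 1) * (Lc : ℝ) * (wid Lc (n + 1) : ℝ) := by
  rw [mem_winF_iff] at h
  unfold l1
  have hterm : ∀ i : Fin (3 + 1), |((((Lc : ℤ) • s - ((Lc ^ (n + 1 + 1) : ℕ) : ℤ) • w) i : ℤ) : ℝ)| ≤ (Lc : ℝ) * (wid Lc (n + 1) : ℝ) := by
    intro i
    obtain ⟨h1, h2⟩ := h i
    have e : (((Lc : ℤ) • s - ((Lc ^ (n + 1 + 1) : ℕ) : ℤ) • w) i : ℤ) = (Lc : ℤ) * (s i - ((Lc ^ (n + 1) : ℕ) : ℤ) * w i) := by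
      simp only [Pi.sub_apply, Pi.smul_apply, smul_eq_mul, Nat.cast_pow]; ring
    rw [e]; push_cast
    rw [abs_mul, abs_of_nonneg (Nat.cast_nonneg Lc)]
    refine mul_le_mul_of_nonneg_left ?_ (Nat.cast_nonneg Lc)
    have h1' : ((((Lc ^ (n + 1) : ℕ) : ℤ) * w i : ℤ) : ℝ) ≤ ((s i : ℤ) : ℝ) := by exact_mod_cast h1
    have h2' : ((s i : ℤ) : ℝ) ≤ ((((Lc ^ (n + 1) : ℕ) : ℤ) * w i : ℤ) : ℝ) + (wid Lc (n + 1) : ℝ) := by exact_mod_cast h2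
    rw [abs_le]; push_cast at h1' h2' ⊢; constructor <;> linarith
  calc ∑ i : Fin (3 + 1), |((((Lc : ℤ) • s - ((Lc ^ (n + 1 + 1) : ℕ) : ℤ) • w) i : ℤ) : ℝ)|
      ≤ ∑ _i : Fin (3 + 1), (Lc : ℝ) * (wid Lc (n + 1) : ℝ) := Finset.sum_le_sum fun i _ => hterm i
    _ = ((3 : ℝ) + 1) * (Lc : ℝ) * (wid Lc (n + 1) : ℝ) := by simp [Finset.sum_const, Finset.card_univ, Fintype.card_fin]; ring

/-- [folklore] **`exists_abs_cfTop_le` — THE TRANSPORTED STRAIGHT COEFFICIENTS DECAY FROM THE SLOT's ROOT**: there are `C ≥ 0` and `δ > 0` (half the decay rate of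
`KInv (Lc^{n+2})`) with `|cfTop μ s κ′ u| ≤ C·e^{−δ|Lc•s − u|₁}` for all `μ s κ′ u` — `cfTop μ s κ′ u = Σ_ν Σ'_w lamCoeffOf (KInv L) L ν w κ′ u·compLinKer … (μ,s) (ν,w)` has its
`w`-sum on the FINITE window above `s` (`compLinKer_eq_zero`), where `|L•w − Lc•s|₁ ≤ 4·Lc·wid`; `lamCoeffOf` decays from `L•w` (lit `abs_lamCoeffOf_le` at `decays_KInv`),
`compLinKer` is bounded (F6a-bounds `abs_compLinKer_le` at `abs_symLinKerAt_le`), and `Σ'_w e^{−(δ₁∕2)|L•w − u|₁} ≤ Zl 4 (δ₁∕2)` by injectivity of `w ↦ L•w`. -/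
theorem exists_abs_cfTop_le : ∃ C δ : ℝ, 0 ≤ C ∧ 0 < δ ∧ ∀ (μ : Fin (3 + 1)) (s : Site (3 + 1)) (κ' : Fin (3 + 1)) (u : Site (3 + 1)),
    |∑ ν : Fin (3 + 1), ∑' w : Site (3 + 1), lamCoeffOf (KInv (N := Lc ^ (n + 1 + 1)) (d := 3)) (Lc ^ (n + 1 + 1)) ν w κ' u
        * compLinKer (fun _ => symLinKerAt (toSite R.r) Lc) Lc (n + 1) (μ, s) (ν, w)|
      ≤ C * Real.exp (-δ * l1 ((Lc : ℤ) • s - u)) := by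
  have hL : 0 < Lc := Nat.pos_of_ne_zero (NeZero.ne Lc)
  have hL1 : 1 ≤ Lc := hL
  obtain ⟨δ₁, C₁, hδ₁, hC₁, hA⟩ := decays_KInv (N := Lc ^ (n + 1 + 1)) (d := 3)
  -- the coefficient bound (lit) and the leg bound (F6a)
  set K₁ : ℝ := (3 : ℝ) ^ (3 + 1) * ((3 + 1 : ℕ) : ℝ) * (16 * ((3 + 1 : ℕ) : ℝ)) * C₁ * Real.exp (((3 + 1 : ℕ) : ℝ) * δ₁) with hK₁
  have hK₁0 : 0 ≤ K₁ := by rw [hK₁]; positivity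
  have hlam : ∀ (ν : Fin (3 + 1)) (w : Site (3 + 1)) (κ' : Fin (3 + 1)) (u : Site (3 + 1)),
      |lamCoeffOf (KInv (N := Lc ^ (n + 1 + 1)) (d := 3)) (Lc ^ (n + 1 + 1)) ν w κ' u|
        ≤ K₁ * Real.exp (-δ₁ * l1 (((Lc ^ (n + 1 + 1) : ℕ) : ℤ) • w - u)) :=
    fun ν w κ' u => abs_lamCoeffOf_le (N := Lc ^ (n + 1 + 1)) hA hC₁ hδ₁.le ν w κ' u
  set B : ℝ := ((((3 : ℕ) : ℝ) + 1) * (2 * (Lc : ℝ)) ^ (3 + 1) * (ell (3 + 1) Lc : ℝ)) ^ (n + 1) with hB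
  have hB0 : 0 ≤ B := by rw [hB]; positivity
  have hleg : ∀ f g : Bond (3 + 1), |compLinKer (fun _ => symLinKerAt (toSite R.r) Lc) Lc (n + 1) f g| ≤ B := fun f g =>
    abs_compLinKer_le (ℓ := fun _ => symLinKerAt (toSite R.r) Lc) (L := Lc) (by positivity : (0 : ℝ) ≤ (ell (3 + 1) Lc : ℝ))
      (fun _ μ' y' f' => abs_symLinKerAt_le hL1 μ' y' R.hr f') (n + 1) f g
  set D : ℝ := ((3 : ℝ) + 1) * (Lc : ℝ) * (wid Lc (n + 1) : ℝ) with hD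
  refine ⟨((3 + 1 : ℕ) : ℝ) * (K₁ * B * Real.exp (δ₁ / 2 * D) * Zl (3 + 1) (δ₁ / 2)), δ₁ / 2, by
    have := Zl_nonneg (D := 3 + 1) (half_pos hδ₁); positivity, half_pos hδ₁, fun μ s κ' u => ?_⟩
  -- per top slot `w`: zero off the window, and on the window the decay re-centred at `Lc•s` with half the rate
  have hterm : ∀ (ν : Fin (3 + 1)) (w : Site (3 + 1)),
      |lamCoeffOf (KInv (N := Lc ^ (n + 1 + 1)) (d := 3)) (Lc ^ (n + 1 + 1)) ν w κ' u
          * compLinKer (fun _ => symLinKerAt (toSite R.r) Lc) Lc (n + 1) (μ, s) (ν, w)|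
        ≤ K₁ * B * Real.exp (δ₁ / 2 * D) * Real.exp (-(δ₁ / 2) * l1 ((Lc : ℤ) • s - u))
            * Real.exp (-(δ₁ / 2) * l1 (((Lc ^ (n + 1 + 1) : ℕ) : ℤ) • w - u)) := by
    intro ν w
    by_cases hw : s ∈ winF (Lc ^ (n + 1)) (wid Lc (n + 1)) w
    · rw [abs_mul]
      have hwin := l1_smul_sub_smul_le_of_mem_winF n hw
      -- `|Lc•s − u| ≤ |Lc•s − L•w| + |L•w − u| ≤ D + |L•w − u|`
      have htri : l1 ((Lc : ℤ) • s - u) ≤ D + l1 (((Lc ^ (n + 1 + 1) : ℕ) : ℤ) • w - u) :=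
        (l1_sub_triangle _ _ _).trans (by rw [hD]; linarith)
      have hexp : Real.exp (-δ₁ * l1 (((Lc ^ (n + 1 + 1) : ℕ) : ℤ) • w - u))
          ≤ Real.exp (δ₁ / 2 * D) * Real.exp (-(δ₁ / 2) * l1 ((Lc : ℤ) • s - u))
              * Real.exp (-(δ₁ / 2) * l1 (((Lc ^ (n + 1 + 1) : ℕ) : ℤ) • w - u)) := by
        rw [← Real.exp_add, ← Real.exp_add, Real.exp_le_exp]
        have := l1_nonneg (((Lc ^ (n + 1 + 1) : ℕ) : ℤ) • w - u)
        nlinarith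
      calc |lamCoeffOf (KInv (N := Lc ^ (n + 1 + 1)) (d := 3)) (Lc ^ (n + 1 + 1)) ν w κ' u|
            * |compLinKer (fun _ => symLinKerAt (toSite R.r) Lc) Lc (n + 1) (μ, s) (ν, w)|
          ≤ (K₁ * Real.exp (-δ₁ * l1 (((Lc ^ (n + 1 + 1) : ℕ) : ℤ) • w - u))) * B :=
            mul_le_mul (hlam ν w κ' u) (hleg _ _) (abs_nonneg _) (mul_nonneg hK₁0 (Real.exp_pos _).le)
        _ ≤ (K₁ * (Real.exp (δ₁ / 2 * D) * Real.exp (-(δ₁ / 2) * l1 ((Lc : ℤ) • s - u))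
              * Real.exp (-(δ₁ / 2) * l1 (((Lc ^ (n + 1 + 1) : ℕ) : ℤ) • w - u)))) * B :=
            mul_le_mul_of_nonneg_right (mul_le_mul_of_nonneg_left hexp hK₁0) hB0
        _ = _ := by ring
    · rw [compLinKer_eq_zero (n + 1) (f := (μ, s)) (g := (ν, w)) hw, mul_zero, abs_zero]
      positivity
  -- the half-rate lattice sum over the top slots is at most `Zl`
  have hLne : ((Lc ^ (n + 1 + 1) : ℕ) : ℤ) ≠ 0 := by exact_mod_cast pow_ne_zero _ (NeZero.ne Lc)
  have hinj : Function.Injective fun w : Site (3 + 1) => ((Lc ^ (n + 1 + 1) : ℕ) : ℤ) • w := fun w w' h => by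
    funext i; have hi := congrFun h i; simp only [Pi.smul_apply, smul_eq_mul] at hi; exact mul_left_cancel₀ hLne hi
  have hsw : Summable fun w : Site (3 + 1) => Real.exp (-(δ₁ / 2) * l1 (((Lc ^ (n + 1 + 1) : ℕ) : ℤ) • w - u)) :=
    (summable_exp_shift' (D := 3 + 1) (half_pos hδ₁) u).comp_injective hinj
  have hZ : (∑' w : Site (3 + 1), Real.exp (-(δ₁ / 2) * l1 (((Lc ^ (n + 1 + 1) : ℕ) : ℤ) • w - u))) ≤ Zl (3 + 1) (δ₁ / 2) := by
    rw [← tsum_exp_shift' (D := 3 + 1) (c := δ₁ / 2) u]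
    exact Summable.tsum_le_tsum_of_inj (fun w : Site (3 + 1) => ((Lc ^ (n + 1 + 1) : ℕ) : ℤ) • w) hinj
      (fun c _ => (Real.exp_pos _).le) (fun w => le_rfl) hsw (summable_exp_shift' (half_pos hδ₁) u)
  -- assemble
  have hsum : ∀ ν : Fin (3 + 1), Summable fun w : Site (3 + 1) =>
      |lamCoeffOf (KInv (N := Lc ^ (n + 1 + 1)) (d := 3)) (Lc ^ (n + 1 + 1)) ν w κ' u
          * compLinKer (fun _ => symLinKerAt (toSite R.r) Lc) Lc (n + 1) (μ, s) (ν, w)| := fun ν =>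
    summable_of_ne_finset_zero (s := Fintype.piFinset fun i =>
      Finset.Icc ((s i - (wid Lc (n + 1) : ℤ)) / ((Lc ^ (n + 1) : ℕ) : ℤ)) (s i / ((Lc ^ (n + 1) : ℕ) : ℤ))) fun w hw => by
        rw [compLinKer_eq_zero (n + 1) (f := (μ, s)) (g := (ν, w)) (fun h => hw (mem_piFinset_of_mem_winF (pow_pos hL (n + 1)) h)),
          mul_zero, abs_zero]
  calc |∑ ν : Fin (3 + 1), ∑' w : Site (3 + 1), lamCoeffOf (KInv (N := Lc ^ (n + 1 + 1)) (d := 3)) (Lc ^ (n + 1 + 1)) ν w κ' u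
          * compLinKer (fun _ => symLinKerAt (toSite R.r) Lc) Lc (n + 1) (μ, s) (ν, w)|
      ≤ ∑ ν : Fin (3 + 1), |∑' w : Site (3 + 1), lamCoeffOf (KInv (N := Lc ^ (n + 1 + 1)) (d := 3)) (Lc ^ (n + 1 + 1)) ν w κ' u
          * compLinKer (fun _ => symLinKerAt (toSite R.r) Lc) Lc (n + 1) (μ, s) (ν, w)| := Finset.abs_sum_le_sum_abs _ _
    _ ≤ ∑ ν : Fin (3 + 1), ∑' w : Site (3 + 1), |lamCoeffOf (KInv (N := Lc ^ (n + 1 + 1)) (d := 3)) (Lc ^ (n + 1 + 1)) ν w κ' u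
          * compLinKer (fun _ => symLinKerAt (toSite R.r) Lc) Lc (n + 1) (μ, s) (ν, w)| :=
        Finset.sum_le_sum fun ν _ => by
          have h := norm_tsum_le_tsum_norm ((hsum ν).congr fun w => (Real.norm_eq_abs _).symm)
          simpa only [Real.norm_eq_abs] using h
    _ ≤ ∑ _ν : Fin (3 + 1), K₁ * B * Real.exp (δ₁ / 2 * D) * Real.exp (-(δ₁ / 2) * l1 ((Lc : ℤ) • s - u)) * Zl (3 + 1) (δ₁ / 2) :=
        Finset.sum_le_sum fun ν _ => by
          calc (∑' w : Site (3 + 1), |lamCoeffOf (KInv (N := Lc ^ (n + 1 + 1)) (d := 3)) (Lc ^ (n + 1 + 1)) ν w κ' u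
                  * compLinKer (fun _ => symLinKerAt (toSite R.r) Lc) Lc (n + 1) (μ, s) (ν, w)|)
              ≤ ∑' w : Site (3 + 1), K₁ * B * Real.exp (δ₁ / 2 * D) * Real.exp (-(δ₁ / 2) * l1 ((Lc : ℤ) • s - u))
                  * Real.exp (-(δ₁ / 2) * l1 (((Lc ^ (n + 1 + 1) : ℕ) : ℤ) • w - u)) :=
                (hsum ν).tsum_le_tsum (hterm ν) (hsw.mul_left _)
            _ = K₁ * B * Real.exp (δ₁ / 2 * D) * Real.exp (-(δ₁ / 2) * l1 ((Lc : ℤ) • s - u))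
                  * ∑' w : Site (3 + 1), Real.exp (-(δ₁ / 2) * l1 (((Lc ^ (n + 1 + 1) : ℕ) : ℤ) • w - u)) := tsum_mul_left
            _ ≤ K₁ * B * Real.exp (δ₁ / 2 * D) * Real.exp (-(δ₁ / 2) * l1 ((Lc : ℤ) • s - u)) * Zl (3 + 1) (δ₁ / 2) :=
                mul_le_mul_of_nonneg_left hZ (by positivity)
    _ = ((3 + 1 : ℕ) : ℝ) * (K₁ * B * Real.exp (δ₁ / 2 * D) * Zl (3 + 1) (δ₁ / 2)) * Real.exp (-(δ₁ / 2) * l1 ((Lc : ℤ) • s - u)) := by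
        rw [Finset.sum_const, Finset.card_univ, Fintype.card_fin, nsmul_eq_mul]; push_cast; ring

end Top

/-! ## §4 The letter `hLS` for the road's storey tables -/

section Stencils

/-- [folklore] **`exists_locStencil_SLam_cf` — THE ROAD's STOREY TABLES MAKE LOCAL Λ-STENCILS, EVERY LEVEL, ANY BLOCKING LETTER**: for the table family
`cfF k = if k = n+1 then cfTop else δ` (`TowerHLinkRows`' `hcfF`) there are ONE rate `δ > 0` and constants `Cs j ≥ 0` with
`LocStencil (SLam N₁ (cfF j) (fun μ y => symHessFFAt (toSite R.r) Lc μ y)) (Cs j) δ` for every `j` — lit `locStencil_SLam` at blocking `Lc` (§2∕§3 for the tables, an2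
`vertexFamily_symHessFFAt` for the brick Hessians), transferred to `N₁` by §1.  (= `lamJunction_of_dper_eq`'s `hLS ∕ hCs ∕ hδ` at `R := Roots.ctr Lc`.) -/
theorem exists_locStencil_SLam_cf (N₁ : ℕ) [NeZero N₁] (cfF : ℕ → Fin (3 + 1) → Site (3 + 1) → Fin (3 + 1) → Site (3 + 1) → ℝ)
    (hcfF : ∀ (k : ℕ) (μ : Fin (3 + 1)) (s : Site (3 + 1)) (κ' : Fin (3 + 1)) (x : Site (3 + 1)), cfF k μ s κ' x
      = if k = n + 1 then
          ∑ ν : Fin (3 + 1), ∑' w : Site (3 + 1), lamCoeffOf (KInv (N := Lc ^ (n + 1 + 1)) (d := 3)) (Lc ^ (n + 1 + 1)) ν w κ' x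
            * compLinKer (fun _ => symLinKerAt (toSite R.r) Lc) Lc (n + 1) (μ, s) (ν, w)
        else (if x = (Lc : ℤ) • s ∧ κ' = μ then (1 : ℝ) else 0)) :
    ∃ δ : ℝ, 0 < δ ∧ ∃ Cs : ℕ → ℝ, (∀ j, 0 ≤ Cs j) ∧
      ∀ j, LocStencil (SLam N₁ (cfF j) (fun μ y => symHessFFAt (toSite R.r) Lc μ y)) (Cs j) δ := by
  have hL1 : 1 ≤ Lc := one_le_of_neZero Lc
  obtain ⟨C, δ, hC, hδ, htop⟩ := exists_abs_cfTop_le R n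
  -- one constant for both tables
  have hc : ∀ (j : ℕ) (μ : Fin (3 + 1)) (y : Site (3 + 1)) (κ' : Fin (3 + 1)) (u : Site (3 + 1)),
      |cfF j μ y κ' u| ≤ max C 1 * Real.exp (-δ * l1 ((Lc : ℤ) • y - u)) := by
    intro j μ y κ' u
    rw [hcfF]
    by_cases hj : j = n + 1
    · rw [if_pos hj]
      exact (htop μ y κ' u).trans (mul_le_mul_of_nonneg_right (le_max_left _ _) (Real.exp_pos _).le)
    · rw [if_neg hj]
      exact (abs_cfDelta_le δ μ y κ' u).trans (mul_le_mul_of_nonneg_right (le_max_right _ _) (Real.exp_pos _).le)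
  have hQ := vertexFamily_symHessFFAt (d := 3) hL1 R.hr hδ.le
  refine ⟨δ / 2, half_pos hδ, fun _ => ((3 + 1 : ℕ) : ℝ) * (max C 1 * (2 * (ell (3 + 1) Lc : ℝ) ^ 2 * Real.exp (4 * ((3 : ℝ) + 1) * Lc * δ))
      * Zl (3 + 1) (δ / 2)), fun _ => ?_, fun j => ?_⟩
  · have := Zl_nonneg (D := 3 + 1) (half_pos hδ)
    have : (0 : ℝ) ≤ max C 1 := le_max_of_le_right zero_le_one
    positivity
  · exact locStencil_SLam_of_neZero N₁ Lc (locStencil_SLam (N := Lc) (d := 3) (hc j) hQ hδ (le_max_of_le_right zero_le_one))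

end Stencils

end Summit.QuantumFields.BalabanUV.Beta.FP.TowerLamStencilLocality

end
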